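import Mathlib
import HarnessLib
import Literature.Probability.MarkovChains.TotalVariation

/-!
# Projections (lumping) of chains and their eigenfunctions (Levin–Peres–Wilmer Lemma 2.5, Lemma 12.9)

HONEST FRAMING: exact (Metropolis-corrected) sampling algorithms for lattice gauge theory; figures
of merit are autocorrelation/cost numbers at stated couplings and volumes; no continuum-physics claim.

Conventions of `MetropolisHastings.lean` / `TotalVariation.lean`: finite `X`, ROW kernel
`P : X → X → ℝ`, `stepLaw P μ = μP`, `lawAt P μ t = μPᵗ`, `IsRowStochastic`, `IsStationary`,
`DetailedBalance`.  Source: D. A. Levin, Y. Peres (with E. L. Wilmer), *Markov Chains and Mixing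
Times*, 2nd ed., AMS 2017 [LevinPeres2017], §2.3.1 "Projections of chains" (Lemma 2.5, p. 25) and
§12.3 Lemma 12.9 (p. 167).  Everything is PROVED (finite sums; 0 named facts, 0 definitions).

The equivalence relation is presented by its quotient map `proj : X → Y` (`[x] = proj x`, classes =
fibres, `Y` finite); `P(x,[c]) = Σ_{z : proj z = c} P(x,z)`.  The LUMPING CONDITION (2.10),
"`P(x,[y]) = P(x′,[y])` whenever `x ∼ x′`", together with the definition `P♯([x],[y]) := P(x,[y])`,
is carried as the single hypothesis `hlump : ∀ x c, P♯ (proj x) c = Σ_{z : proj z = c} P(x,z)` on a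
kernel `P♯ : Y → Y → ℝ` (`exists_lumpedKernel`: under (2.10) and for a surjective `proj` such a
`P♯` exists); laws project by `μ♯(c) = Σ_{x : proj x = c} μ(x)`.

* `exists_lumpedKernel` — (2.10) ⇒ `P♯` is well defined [cite: LevinPeres2017, §2.3.1 Lemma 2.5];
* **LEMMA 2.5 (law level)** `LevinPeres2017_lemma_2_5_stepLaw` / `_lawAt`: the projected laws
  evolve by `P♯` — `(μP)♯ = μ♯P♯`, `(μPᵗ)♯ = μ♯(P♯)ᵗ` ("`([X_t])` is a Markov chain with …
  transition matrix `P♯`"; typed at the level of the one-time marginals) [cite: LevinPeres2017,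
  §2.3.1 Lemma 2.5]; `lumpedKernel_isRowStochastic`, `lumpedKernel_isStationary` (`π♯` is
  stationary for `P♯`), `lumpedKernel_detailedBalance` (reversibility projects);
* **LEMMA 12.9 (i)** `LevinPeres2017_lemma_12_9_i`: an eigenfunction of `P` that is constant on
  classes, `f = f♯ ∘ proj`, projects to an eigenfunction `f♯` of `P♯` with the same eigenvalue;
  **(ii)** `LevinPeres2017_lemma_12_9_ii`: an eigenfunction `g` of `P♯` lifts to the eigenfunction
  `g♭ = g ∘ proj` of `P` with the same eigenvalue [cite: LevinPeres2017, §12.3 Lemma 12.9].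

Context (cell pub-lqcd, venture LatticeQCDFlow): a gauge-covariant update watched through
gauge-invariant observables is a projection in this sense (classes = gauge orbits); Lemma 12.9 (ii)
says every relaxation rate seen on the quotient is a relaxation rate of the full chain, so
autocorrelation times measured on gauge-invariant observables are honest lower bounds for `t_rel`
of the configuration chain.
-/

namespace Literature.Probability.MarkovChains

open Finset

variable {X Y : Type*} [Fintype X] [Fintype Y] [DecidableEq Y]

section Lumping

variable {P : X → X → ℝ} {Ps : Y → Y → ℝ} {proj : X → Y}

omit [Fintype Y] in
/-- Under the lumping condition (2.10) — `P(x,[c]) = P(x′,[c])` whenever `[x] = [x′]` — and for a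
surjective class map, `P♯([x],[c]) := P(x,[c])` is a well-defined kernel on the classes.
[cite: LevinPeres2017, §2.3.1 Lemma 2.5 (eq. (2.10) and the definition of `P♯`)] -/
theorem exists_lumpedKernel (hproj : Function.Surjective proj)
    (h210 : ∀ x x', proj x = proj x' → ∀ c,
      ∑ z ∈ univ.filter (fun z => proj z = c), P x z = ∑ z ∈ univ.filter (fun z => proj z = c), P x' z) :
    ∃ Ps : Y → Y → ℝ, ∀ x c, Ps (proj x) c = ∑ z ∈ univ.filter (fun z => proj z = c), P x z := by
  refine ⟨fun y c => ∑ z ∈ univ.filter (fun z => proj z = c), P (Function.surjInv hproj y) z,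
    fun x c => ?_⟩
  exact h210 _ _ (Function.surjInv_eq hproj (proj x)) c

/-- `Σ_c P♯([x],c) g(c) = Σ_z P(x,z) g([z])` — summing over classes and then inside a class is
summing over states. [cite: LevinPeres2017, §12.3 Lemma 12.9 (proof: "`Σ_{[y]} Σ_{z ∈ [y]} P(x,z)f(z)
= Σ_{z ∈ X} P(x,z)f(z)`")] -/
theorem sum_lumpedKernel_mul
    (hlump : ∀ x c, Ps (proj x) c = ∑ z ∈ univ.filter (fun z => proj z = c), P x z)
    (x : X) (g : Y → ℝ) : ∑ c, Ps (proj x) c * g c = ∑ z, P x z * g (proj z) := by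
  simp_rw [hlump, sum_mul]
  rw [← Finset.sum_fiberwise univ proj (fun z => P x z * g (proj z))]
  refine sum_congr rfl fun c _ => sum_congr rfl fun z hz => ?_
  rw [(mem_filter.mp hz).2]

/-- The projected kernel of a transition matrix is a transition matrix (surjective class map).
[cite: LevinPeres2017, §2.3.1 Lemma 2.5] -/
theorem lumpedKernel_isRowStochastic (hP : IsRowStochastic P) (hproj : Function.Surjective proj)
    (hlump : ∀ x c, Ps (proj x) c = ∑ z ∈ univ.filter (fun z => proj z = c), P x z) :
    IsRowStochastic Ps := by
  refine ⟨fun y c => ?_, fun y => ?_⟩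
  · obtain ⟨x, rfl⟩ := hproj y
    rw [hlump]
    exact sum_nonneg fun z _ => hP.1 x z
  · obtain ⟨x, rfl⟩ := hproj y
    have h := sum_lumpedKernel_mul hlump x (fun _ => 1)
    simp only [mul_one] at h
    rw [h, hP.2 x]

/-- **LEMMA 2.5 (one step, at the level of laws)**: the projected law of `μP` is the projected law
of `μ` advanced by `P♯`: `(μP)♯(c) = Σ_{c'} μ♯(c') P♯(c',c)` — "`([X_t])` is a Markov chain with
state space `X♯` and transition matrix `P♯`". [cite: LevinPeres2017, §2.3.1 Lemma 2.5] -/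
theorem LevinPeres2017_lemma_2_5_stepLaw
    (hlump : ∀ x c, Ps (proj x) c = ∑ z ∈ univ.filter (fun z => proj z = c), P x z)
    (μ : X → ℝ) (c : Y) :
    ∑ x ∈ univ.filter (fun x => proj x = c), stepLaw P μ x
      = stepLaw Ps (fun c' => ∑ x ∈ univ.filter (fun x => proj x = c'), μ x) c := by
  unfold stepLaw
  -- right side: `Σ_{c'} (Σ_{x ∈ c'} μ x) P♯(c',c) = Σ_x μ x P♯([x],c) = Σ_x μ x Σ_{z ∈ c} P(x,z)`
  have hR : ∑ c', (∑ x ∈ univ.filter (fun x => proj x = c'), μ x) * Ps c' c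
      = ∑ x, μ x * ∑ z ∈ univ.filter (fun z => proj z = c), P x z := by
    simp_rw [sum_mul]
    rw [← Finset.sum_fiberwise univ proj (fun x => μ x * ∑ z ∈ univ.filter (fun z => proj z = c), P x z)]
    refine sum_congr rfl fun c' _ => sum_congr rfl fun x hx => ?_
    rw [← (mem_filter.mp hx).2, hlump]
  rw [hR]
  -- left side: `Σ_{z ∈ c} Σ_x μ x P(x,z)`
  rw [sum_comm]
  simp_rw [mul_sum]

/-- **LEMMA 2.5 (all times, at the level of laws)**: `(μPᵗ)♯ = μ♯ (P♯)ᵗ`.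
[cite: LevinPeres2017, §2.3.1 Lemma 2.5] -/
theorem LevinPeres2017_lemma_2_5_lawAt
    (hlump : ∀ x c, Ps (proj x) c = ∑ z ∈ univ.filter (fun z => proj z = c), P x z)
    (μ : X → ℝ) (t : ℕ) (c : Y) :
    ∑ x ∈ univ.filter (fun x => proj x = c), lawAt P μ t x
      = lawAt Ps (fun c' => ∑ x ∈ univ.filter (fun x => proj x = c'), μ x) t c := by
  induction t generalizing c with
  | zero => rfl
  | succ t ih =>
    rw [lawAt_succ, lawAt_succ, LevinPeres2017_lemma_2_5_stepLaw hlump]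
    unfold stepLaw
    exact sum_congr rfl fun c' _ => by
      show (∑ x ∈ univ.filter (fun x => proj x = c'), lawAt P μ t x) * Ps c' c = _
      rw [ih c']

omit [DecidableEq Y] in
/-- The projected law `π♯` of a stationary `π` is stationary for `P♯`.
[cite: LevinPeres2017, §2.3.1 Lemma 2.5 (with §1.5: stationarity)] -/
theorem lumpedKernel_isStationary [DecidableEq Y] {π : X → ℝ} (hst : IsStationary π P)
    (hlump : ∀ x c, Ps (proj x) c = ∑ z ∈ univ.filter (fun z => proj z = c), P x z) :
    IsStationary (fun c => ∑ x ∈ univ.filter (fun x => proj x = c), π x) Ps := by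
  intro c
  have h := LevinPeres2017_lemma_2_5_stepLaw hlump π c
  unfold stepLaw at h
  rw [← h]
  exact sum_congr rfl fun x _ => hst x

omit [Fintype Y] in
/-- **Reversibility projects**: if `π` is reversible for `P`, then `π♯` is reversible for `P♯`
(`π♯(c)P♯(c,c') = Σ_{x ∈ c, z ∈ c'} π(x)P(x,z)` is symmetric in `c, c'`).
[cite: LevinPeres2017, §2.3.1 Lemma 2.5 (with §1.6 eq. (1.29))] -/
theorem lumpedKernel_detailedBalance {π : X → ℝ} (hDB : DetailedBalance π P)
    (hlump : ∀ x c, Ps (proj x) c = ∑ z ∈ univ.filter (fun z => proj z = c), P x z) :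
    DetailedBalance (fun c => ∑ x ∈ univ.filter (fun x => proj x = c), π x) Ps := by
  intro c c'
  have key : ∀ a b : Y, (∑ x ∈ univ.filter (fun x => proj x = a), π x) * Ps a b
      = ∑ x ∈ univ.filter (fun x => proj x = a), ∑ z ∈ univ.filter (fun z => proj z = b),
          π x * P x z := by
    intro a b
    rw [sum_mul]
    refine sum_congr rfl fun x hx => ?_
    rw [← (mem_filter.mp hx).2, hlump, mul_sum]
  rw [key, key, sum_comm]
  exact sum_congr rfl fun x _ => sum_congr rfl fun z _ => hDB z x

end Lumping

/-! ## LEMMA 12.9: eigenfunctions of the projected chain -/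

section Eigen

variable {P : X → X → ℝ} {Ps : Y → Y → ℝ} {proj : X → Y}

/-- **LEMMA 12.9 (i)**: let `f` be an eigenfunction of `P` with eigenvalue `λ` which is constant on
each class, `f = f♯ ∘ proj`; then `f♯` is an eigenfunction of `P♯` with eigenvalue `λ` (class map
surjective). [cite: LevinPeres2017, §12.3 Lemma 12.9 (i)] -/
theorem LevinPeres2017_lemma_12_9_i (hproj : Function.Surjective proj)
    (hlump : ∀ x c, Ps (proj x) c = ∑ z ∈ univ.filter (fun z => proj z = c), P x z)
    {fs : Y → ℝ} {lam : ℝ} (hf : ∀ x, ∑ z, P x z * fs (proj z) = lam * fs (proj x)) :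
    ∀ y, ∑ c, Ps y c * fs c = lam * fs y := by
  intro y
  obtain ⟨x, rfl⟩ := hproj y
  rw [sum_lumpedKernel_mul hlump x fs, hf x]

/-- **LEMMA 12.9 (ii)**: conversely, if `g : X♯ → ℝ` is an eigenfunction of `P♯` with eigenvalue
`λ`, then its lift `g♭ = g ∘ proj` is an eigenfunction of `P` with eigenvalue `λ`.
[cite: LevinPeres2017, §12.3 Lemma 12.9 (ii)] -/
theorem LevinPeres2017_lemma_12_9_ii
    (hlump : ∀ x c, Ps (proj x) c = ∑ z ∈ univ.filter (fun z => proj z = c), P x z)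
    {g : Y → ℝ} {lam : ℝ} (hg : ∀ y, ∑ c, Ps y c * g c = lam * g y) :
    ∀ x, ∑ z, P x z * g (proj z) = lam * g (proj x) := by
  intro x
  rw [← sum_lumpedKernel_mul hlump x g, hg (proj x)]

end Eigen

end Literature.Probability.MarkovChains
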